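import Summits.AtomisticToContinuum.HydrodynamicLimit.Theorems.JaynesSqueezeHardSphereLDAInsertion
import HarnessLib

/-!
# Hard-sphere local density approximation, Ic: `L¹`-stability of the canonical free energy in the field

Helper file for the support item `HardSphereLDA` (stmt-AtomisticToContinuum-13459) of route
`JaynesSqueeze`. Combining the convexity lower bound (`log_posPartition_tilt_ge`, file Ia) with the
one-point insertion bound (`posPartition_inv_mul_integral_sum_abs_le`, file Ib):

* `log_posPartition_tilt_sub_ge` — `log Z(a e^ψ) − log Z(a) ≥ −n (∫ a|ψ|)/(∫a − n A v₁ ε³)`;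
* `abs_log_posPartition_sub_le` — for two measurable activities `0 < a ≤ A`, `0 < a' ≤ A'` with
  `n (max A A') v₁ ε³ < min ∫a ∫a'`:
  `|log Z(a') − log Z(a)| ≤ n (max A A') (∫ |log a' − log a|) / (min ∫a ∫a' − n (max A A') v₁ ε³)`
  (tilt `a` to `a'` and back).

This `L¹`-Lipschitz control, uniform in the particle number at fixed reduced density
(`n ε³ = σ³`), is what transfers the local density approximation from continuous to measurable
density profiles. No definitions. prover-pitem-stmt-AtomisticToContinuum-13459-0.
-/

noncomputable section

namespace Summit.AtomisticToContinuum.HydrodynamicLimit.Theorems.HardSphereLDA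

open MeasureTheory Filter Set Topology
open scoped ENNReal
open Literature.MathematicalPhysics.KineticTheory Literature.Analysis.FluidPDE

variable {a : T3 → ℝ} {ε : ℝ} {n : ℕ}

/-! ### `L¹`-stability of the free energy in the field -/

/-- **Lower stability bound.** `log Z(a e^ψ) − log Z(a) ≥ −n (∫ a|ψ|)/(∫a − n A v₁ ε³)`. [folklore] -/
theorem log_posPartition_tilt_sub_ge (ha : Measurable a) (ha0 : ∀ y, 0 ≤ a y) {A : ℝ} (hA : ∀ y, a y ≤ A)
    {ε : ℝ} (hε : 0 ≤ ε) (hε2 : ε < 1 / 2) {ψ : T3 → ℝ} (hψ : Measurable ψ) {C : ℝ}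
    (hψC : ∀ y, |ψ y| ≤ C) (hZ : 0 < posPartition a ε n) (hgap : n * A * (v₁ * ε ^ 3) < ∫ y, a y) :
    -(n * ((∫ y, a y * |ψ y|) / ((∫ y, a y) - n * A * (v₁ * ε ^ 3)))) ≤
      Real.log (posPartition (fun y => a y * Real.exp (ψ y)) ε n) - Real.log (posPartition a ε n) := by
  have hA0 : 0 ≤ A := (ha0 0).trans (hA 0)
  have hC : 0 ≤ C := (abs_nonneg _).trans (hψC 0)
  have hJ := log_posPartition_tilt_ge ha ha0 hA hψ hψC ε n hZ
  have h1 := posPartition_inv_mul_integral_sum_abs_le ha ha0 hA hε hε2 hψ hψC hgap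
  have hwm : Measurable (posWeight a ε n) := measurable_posWeight_of_measurable ha ε n
  -- `-∑|ψ| ≤ ∑ ψ`
  have hmono : -((posPartition a ε n)⁻¹ * ∫ x, posWeight a ε n x * ∑ i, |ψ (x i)|) ≤
      (posPartition a ε n)⁻¹ * ∫ x, posWeight a ε n x * ∑ i, ψ (x i) := by
    rw [← mul_neg, ← integral_neg]
    refine mul_le_mul_of_nonneg_left (integral_mono ?_ ?_ fun x => ?_) (inv_nonneg.2 hZ.le)
    · exact (integrable_config_of_abs_le (f := fun x => posWeight a ε n x * ∑ i, |ψ (x i)|)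
        (hwm.mul (measurable_sum_apply hψ.abs)) (K := A ^ n * (n * C)) fun x => by
        rw [abs_mul]
        refine mul_le_mul (abs_posWeight_le ha0 hA ε x) ?_ (abs_nonneg _) (pow_nonneg hA0 n)
        exact abs_sum_apply_le' (ψ := fun y => |ψ y|) (fun y => by rw [abs_abs]; exact hψC y) x).neg
    · exact integrable_config_of_abs_le (f := fun x => posWeight a ε n x * ∑ i, ψ (x i))
        (hwm.mul (measurable_sum_apply hψ)) (K := A ^ n * (n * C)) fun x => by
        rw [abs_mul]
        exact mul_le_mul (abs_posWeight_le ha0 hA ε x) (abs_sum_apply_le' hψC x) (abs_nonneg _)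
          (pow_nonneg hA0 n)
    · dsimp only
      rw [← mul_neg]
      refine mul_le_mul_of_nonneg_left ?_ (posWeight_nonneg ha0 ε x)
      rw [← Finset.sum_neg_distrib]
      exact Finset.sum_le_sum fun i _ => neg_abs_le _
  linarith

/-- **`L¹`-STABILITY OF THE CANONICAL FREE ENERGY IN THE FIELD.** For two measurable activities
`0 < a ≤ A`, `0 < a' ≤ A'` (`n` spheres of diameter `0 ≤ ε < 1/2` on `𝕋³`) with
`n (max A A') v₁ ε³ < min ∫a ∫a'`:
`|log Z(a') − log Z(a)| ≤ n (max A A') (∫ |log a' − log a|) / (min ∫a ∫a' − n (max A A') v₁ ε³)`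
— tilting `a` to `a'` and back, by `log_posPartition_tilt_sub_ge`. [folklore] -/
theorem abs_log_posPartition_sub_le {a a' : T3 → ℝ} (ha : Measurable a) (ha' : Measurable a')
    (ha0 : ∀ y, 0 < a y) (ha0' : ∀ y, 0 < a' y) {A A' : ℝ} (hA : ∀ y, a y ≤ A) (hA' : ∀ y, a' y ≤ A')
    {B : ℝ} (hB : ∀ y, |Real.log (a' y) - Real.log (a y)| ≤ B)
    {ε : ℝ} (hε : 0 ≤ ε) (hε2 : ε < 1 / 2) (hZ : 0 < posPartition a ε n) (hZ' : 0 < posPartition a' ε n)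
    (hgap : n * max A A' * (v₁ * ε ^ 3) < min (∫ y, a y) (∫ y, a' y)) :
    |Real.log (posPartition a' ε n) - Real.log (posPartition a ε n)| ≤
      n * (max A A' * (∫ y, |Real.log (a' y) - Real.log (a y)|) /
        (min (∫ y, a y) (∫ y, a' y) - n * max A A' * (v₁ * ε ^ 3))) := by
  set ψ : T3 → ℝ := fun y => Real.log (a' y) - Real.log (a y) with hψ
  set M := max A A' with hM
  set L := ∫ y, |Real.log (a' y) - Real.log (a y)| with hL
  set D := min (∫ y, a y) (∫ y, a' y) - n * M * (v₁ * ε ^ 3) with hD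
  have hψm : Measurable ψ := (Real.measurable_log.comp ha').sub (Real.measurable_log.comp ha)
  have hnψm : Measurable fun y => -ψ y := hψm.neg
  have hAM : ∀ y, a y ≤ M := fun y => (hA y).trans (le_max_left _ _)
  have hAM' : ∀ y, a' y ≤ M := fun y => (hA' y).trans (le_max_right _ _)
  have hM0 : 0 ≤ M := (ha0 0).le.trans (hAM 0)
  have hD0 : 0 < D := by rw [hD]; linarith
  have hn0 : (0 : ℝ) ≤ n := Nat.cast_nonneg n
  have hL0 : 0 ≤ L := integral_nonneg fun y => abs_nonneg _
  have hgap1 : n * M * (v₁ * ε ^ 3) < ∫ y, a y := lt_of_lt_of_le hgap (min_le_left _ _)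
  have hgap2 : n * M * (v₁ * ε ^ 3) < ∫ y, a' y := lt_of_lt_of_le hgap (min_le_right _ _)
  -- `a' = a e^ψ` and `a = a' e^{-ψ}`
  have ha'eq : (fun y => a y * Real.exp (ψ y)) = a' := by
    funext y
    rw [hψ]; dsimp only
    rw [Real.exp_sub, Real.exp_log (ha0' y), Real.exp_log (ha0 y), mul_div_cancel₀ _ (ha0 y).ne']
  have haeq : (fun y => a' y * Real.exp (-ψ y)) = a := by
    funext y
    rw [hψ]; dsimp only
    rw [neg_sub, Real.exp_sub, Real.exp_log (ha0' y), Real.exp_log (ha0 y), mul_div_cancel₀ _ (ha0' y).ne']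
  -- integrability of `a|ψ|`, `a'|ψ|` and the bounds by `M L`
  have hintψ : Integrable (fun y => |Real.log (a' y) - Real.log (a y)|) :=
    integrable_T3_of_abs_le hψm.abs fun y => by rw [abs_abs]; exact hB y
  have hbd1 : (∫ y, a y * |ψ y|) ≤ M * L := by
    rw [hL, ← integral_const_mul]
    refine integral_mono_of_nonneg (Eventually.of_forall fun y => mul_nonneg (ha0 y).le (abs_nonneg _))
      (hintψ.const_mul M) (Eventually.of_forall fun y => ?_)
    exact mul_le_mul_of_nonneg_right (hAM y) (abs_nonneg _)
  have hbd2 : (∫ y, a' y * |(-ψ y)|) ≤ M * L := by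
    simp_rw [abs_neg]
    rw [hL, ← integral_const_mul]
    refine integral_mono_of_nonneg (Eventually.of_forall fun y => mul_nonneg (ha0' y).le (abs_nonneg _))
      (hintψ.const_mul M) (Eventually.of_forall fun y => ?_)
    exact mul_le_mul_of_nonneg_right (hAM' y) (abs_nonneg _)
  -- the two tilting bounds
  have h1 := log_posPartition_tilt_sub_ge (n := n) ha (fun y => (ha0 y).le) hAM hε hε2 hψm hB hZ hgap1
  have h2 := log_posPartition_tilt_sub_ge (n := n) ha' (fun y => (ha0' y).le) hAM' hε hε2 hnψm
    (fun y => by rw [abs_neg]; exact hB y) hZ' hgap2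
  rw [ha'eq] at h1
  rw [haeq] at h2
  -- compare the explicit bounds with the symmetric one
  have hq1 : n * ((∫ y, a y * |ψ y|) / ((∫ y, a y) - n * M * (v₁ * ε ^ 3))) ≤ n * (M * L / D) := by
    refine mul_le_mul_of_nonneg_left ?_ hn0
    have hd : D ≤ (∫ y, a y) - n * M * (v₁ * ε ^ 3) := by
      rw [hD]; linarith [min_le_left (∫ y, a y) (∫ y, a' y)]
    exact div_le_div₀ (by positivity) hbd1 hD0 hd
  have hq2 : n * ((∫ y, a' y * |(-ψ y)|) / ((∫ y, a' y) - n * M * (v₁ * ε ^ 3))) ≤ n * (M * L / D) := by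
    refine mul_le_mul_of_nonneg_left ?_ hn0
    have hd : D ≤ (∫ y, a' y) - n * M * (v₁ * ε ^ 3) := by
      rw [hD]; linarith [min_le_right (∫ y, a y) (∫ y, a' y)]
    exact div_le_div₀ (by positivity) hbd2 hD0 hd
  rw [abs_le]
  constructor <;> linarith

end Summit.AtomisticToContinuum.HydrodynamicLimit.Theorems.HardSphereLDA

end
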